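import Literature.Geometry.Riemannian.GurskyViaclovskyOpennessProofs
import Literature.Geometry.Riemannian.GurskyViaclovskyEllipticity
import Literature.Geometry.Riemannian.EllipticMaximumPrincipleClosed
import Literature.Geometry.Lorentzian.HessianLinear
import HarnessLib

/-!
# Gursky–Viaclovsky 2003, Prop. 2: the linearisation of the weighted `σ₂` path equation on the
# background, its ellipticity on `Γ₂⁺` for `t ≤ 1`, and the triviality of its kernel

Support file (everything PROVED; definitions with bodies, no named fact) for the named fact
`Literature.Geometry.Riemannian.gurskyViaclovsky_pathOpen_weighted_four`
(`GurskyViaclovskyOpenness.lean`), continuing `GurskyViaclovskyOpennessProofs.lean` (the path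
equation on the background: `backgroundPathOperator g t w = q e^{−4w}`, `w = −u`),
`GurskyViaclovskyEllipticity.lean` (Prop. 1 (ii): `L^t(A) > 0` on `Γ₂⁺`, `t ≤ 1`) and
`EllipticMaximumPrincipleClosed.lean` (the maximum principle). Gursky–Viaclovsky, J. Differential
Geom. 63 (2003), §2, proof of Prop. 2: "Define `u_s = u + sφ`, then
`𝓛^t(φ) = d/ds F_t[x, u_s, ∇u_s, ∇²u_s]|_{s=0} = L^t(g⁻¹A^t_u)_{ij}(g⁻¹∇²φ)_{ij} − 4f²e^{4u}φ + ⋯`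
… For `t ≤ 1`, `L^t(g⁻¹A^t_u)` is positive definite, so `𝓛^t` is elliptic. Since the
coefficient of `φ` in the zeroth-order term is strictly negative, the linearization is
furthermore invertible". Here, for the tree's background operator (a function of
`Hess_g w, dw, Δ_g w` and the curvature of `g`):

* `principalForm g t w x` — the bilinear form `P = 2Ric − c₁ g − 4Hess w + 4dw⊗dw`,
  `c₁ = R − 4Δw − 2|dw|² + 2(1−t)(2−t)ρ`, `ρ = backgroundScalar g w`, paired with `Hess φ` in the
  linearisation; `firstOrderField g t w x` — the vector field paired with `dφ`;
  `linearisedBackgroundOperator g t w φ = ⟨P, Hess φ⟩_g + dφ(b)`;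
* `hasDerivAt_backgroundPathOperator` — **`d/ds backgroundPathOperator g t (w + sφ)(x)|₀ =
  linearisedBackgroundOperator g t w φ x`** (the tree's `hessian_add_const_mul`,
  `gradSq_add_const_mul`, … along the affine line, then one-variable calculus);
* `weylSchoutenT g t w x` — the form `𝔄^t_w = A_g − 2Hess w + 2dw⊗dw − |dw|²g + ((1−t)/6)ρ g`
  (`= 2A^t_h` of the conformal metric `h = e^{2w}g` read on `g`; Chang–Gursky–Yang 2002, (0.4));
  `backgroundPathOperator_eq_sigma2` — **`backgroundPathOperator g t w = ½((tr 𝔄^t)² − |𝔄^t|²)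
  − ¼|W_g|²`**, so at a solution `𝔄^t ∈ Γ₂⁺`; `principalForm_apply_self` —
  **`−½P = L^t(𝔄^t)`**, hence `−P > 0` for `t ≤ 1` at an admissible solution (Prop. 1 (ii),
  `apply_self_lt_Lt_mul`): the ellipticity of `𝓛^t`;
* `eq_zero_of_linearised_eq_zero` — **the kernel of `φ ↦ 𝓛φ + 4q e^{−4w}φ` (the linearisation of
  `w ↦ backgroundPathOperator g t w − q e^{−4w}`) on `C²(M)` is trivial** at an admissible solution
  with `t ≤ 1`, `q > 0`, `M` closed: the injectivity half of Prop. 2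
  (`eq_zero_of_maximumPrinciple`).

What is NOT here: the surjectivity half of Prop. 2 (Schauder theory in `C^{2,α}(M)`), the
implicit function theorem in those spaces and elliptic regularity — the analytic core recorded
in `GurskyViaclovskyOpennessProofs.lean`.

## References

* M. J. Gursky, J. A. Viaclovsky, J. Differential Geom. 63 (2003) 131–154, arXiv:math/0301350,
  §2, Def. 2, Prop. 1 (ii), Prop. 2 and its proof. [GurskyViaclovsky2003]
* S.-Y. A. Chang, M. J. Gursky, P. C. Yang, Ann. of Math. 155 (2002), (0.4). [ChangGurskyYang2002]
-/

noncomputable section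

open Set Filter Module
open scoped Manifold ContDiff Topology

namespace Literature.Geometry.Riemannian.GurskyViaclovskyPath

open Literature.Geometry.Lorentzian (PseudoRiemannianMetric)
open Literature.Geometry.Lorentzian.PseudoRiemannianMetric

/-! ### Metric pairings of rank-one forms and of the metric -/

section Pairings

variable {E : Type*} [NormedAddCommGroup E] [NormedSpace ℝ E] {H : Type*} [TopologicalSpace H]
  {I : ModelWithCorners ℝ E H} {M : Type*} [TopologicalSpace M] [ChartedSpace H M]
  [IsManifold I ∞ M] {n : ℕ∞ω} [FiniteDimensional ℝ E]
  (g : PseudoRiemannianMetric I n E (TangentSpace I : M → Type _)) (x : M)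

/-- The rank-one form `(v, w) ↦ α(v) β(w)` raised by `♯` is `v ↦ α(v) ♯β`. [folklore] -/
theorem sharp_comp_smulRight (α β : Module.Dual ℝ (TangentSpace I x)) :
    (g.sharp x).toLinearMap ∘ₗ (α.smulRight β) = α.smulRight (g.sharp x β) := by
  ext v
  simp only [LinearMap.comp_apply, LinearMap.smulRight_apply, LinearEquiv.coe_coe, map_smul]

/-- **`⟨S, α ⊗ β⟩_g = S(♯α, ♯β)`**: the metric pairing of a bilinear form with a rank-one form
(`S_{ij} αⁱ βʲ`; O'Neill 1983, Ch. 3, pp. 60–61). [cite: ONeill1983, Ch. 3, pp. 60–61] -/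
theorem innerBilin_smulRight (S : LinearMap.BilinForm ℝ (TangentSpace I x))
    (α β : Module.Dual ℝ (TangentSpace I x)) :
    g.innerBilin x S (α.smulRight β) = S (g.sharp x α) (g.sharp x β) := by
  haveI : FiniteDimensional ℝ (TangentSpace I x) := ‹FiniteDimensional ℝ E›
  have hflip : LinearMap.BilinForm.flip (α.smulRight β) = β.smulRight α := by
    ext v w
    simp [mul_comm]
  have h1 : ((g.sharp x).toLinearMap ∘ₗ S) ∘ₗ
      ((g.sharp x).toLinearMap ∘ₗ LinearMap.BilinForm.flip (α.smulRight β)) =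
      β.smulRight (g.sharp x (S (g.sharp x α))) := by
    rw [hflip, sharp_comp_smulRight]
    ext v
    simp only [LinearMap.comp_apply, LinearMap.smulRight_apply, LinearEquiv.coe_coe, map_smul]
  rw [innerBilin, h1, LinearMap.trace_smulRight]
  change g.innerDual x β (S (g.sharp x α)) = _
  rw [g.innerDual_comm x]
  rfl

/-- **`⟨S, g⟩_g = tr_g S`**: pairing with the metric is the metric trace (`g^{ij} S_{ij}`).
[cite: ONeill1983, Ch. 3, pp. 60–61] -/
theorem innerBilin_toBilinForm (S : LinearMap.BilinForm ℝ (TangentSpace I x)) :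
    g.innerBilin x S (g.toBilinForm x) = g.trace x S := by
  have hflip : (g.toBilinForm x).flip = g.toBilinForm x := by
    ext v w
    simp [g.symm x v w]
  have hid : (g.sharp x).toLinearMap ∘ₗ (g.toBilinForm x) = LinearMap.id := by
    ext v
    simp only [LinearMap.comp_apply, LinearEquiv.coe_coe, LinearMap.id_apply]
    exact g.sharp_flat x v
  rw [innerBilin, hflip, hid, LinearMap.comp_id]
  rfl

/-- `(α ⊗ α)(♯α, ♯α) = g⁻¹(α, α)²`. [folklore] -/
theorem smulRight_apply_sharp_sharp (α : Module.Dual ℝ (TangentSpace I x)) :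
    (α.smulRight α) (g.sharp x α) (g.sharp x α) = g.innerDual x α α ^ 2 := by
  simp only [LinearMap.smulRight_apply, LinearMap.smul_apply, smul_eq_mul, innerDual]
  ring

/-- `tr_g g = 4` on a `4`-dimensional model. [cite: ONeill1983, Ch. 3, Lemma 3.36] -/
theorem trace_toBilinForm_four (hE : finrank ℝ E = 4) : g.trace x (g.toBilinForm x) = 4 := by
  rw [trace_toBilinForm_holds g x]
  haveI : FiniteDimensional ℝ (TangentSpace I x) := ‹FiniteDimensional ℝ E›
  have : finrank ℝ (TangentSpace I x) = 4 := hE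
  exact_mod_cast this

end Pairings

/-! ### Two more pieces of bookkeeping along an affine line of functions -/

section Affine

variable {E : Type*} [NormedAddCommGroup E] [NormedSpace ℝ E] {H : Type*} [TopologicalSpace H]
  {I : ModelWithCorners ℝ E H} {M : Type*} [TopologicalSpace M] [ChartedSpace H M]
  [IsManifold I ∞ M] {n : ℕ∞ω} [FiniteDimensional ℝ E]
  (g : PseudoRiemannianMetric I n E (TangentSpace I : M → Type _)) (x : M)

omit [IsManifold I ∞ M] [FiniteDimensional ℝ E] in
/-- `d(u + s v)_x = du_x + s dv_x` as covectors. [folklore] -/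
theorem mvfderiv_toLinearMap_add_const_mul {u v : M → ℝ} (hu : MDifferentiableAt I 𝓘(ℝ, ℝ) u x)
    (hv : MDifferentiableAt I 𝓘(ℝ, ℝ) v x) (s : ℝ) :
    (mvfderiv I (fun y ↦ u y + s * v y) x).toLinearMap =
      (mvfderiv I u x).toLinearMap + s • (mvfderiv I v x).toLinearMap := by
  refine LinearMap.ext fun a ↦ ?_
  simp only [ContinuousLinearMap.coe_coe, LinearMap.add_apply, LinearMap.smul_apply,
    smul_eq_mul, mvfderiv_add_const_mul_apply hu hv s a]

/-- Expansion of `|S + s T|²_g` (`normSq = innerBilin` on the diagonal, bilinear and symmetric).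
[folklore] -/
theorem normSq_add_smul (S T : LinearMap.BilinForm ℝ (TangentSpace I x)) (s : ℝ) :
    g.normSq x (S + s • T) = g.normSq x S + 2 * s * g.innerBilin x S T + s ^ 2 * g.normSq x T := by
  rw [← innerBilin_self, ← innerBilin_self, ← innerBilin_self, innerBilin_add_left,
    innerBilin_add_right, innerBilin_add_right, innerBilin_smul_left, innerBilin_smul_left,
    innerBilin_smul_right, innerBilin_smul_right, g.innerBilin_comm x T S]
  ring

/-- `α(♯γ) = γ(♯α)` (the symmetry of `g⁻¹`, `innerDual_comm`, unfolded). [folklore] -/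
theorem apply_sharp_comm (α γ : Module.Dual ℝ (TangentSpace I x)) :
    α (g.sharp x γ) = γ (g.sharp x α) :=
  g.innerDual_comm x α γ

end Affine

/-! ### The linearised operator -/

section Linearisation

variable {M : Type*} [TopologicalSpace M] [ChartedSpace (EuclideanSpace ℝ (Fin 4)) M]
  [IsManifold (𝓡 4) ∞ M]
  (g : PseudoRiemannianMetric (𝓡 4) ∞ (EuclideanSpace ℝ (Fin 4)) (TangentSpace (𝓡 4) : M → Type _))
  [g.HasLeviCivita]

/-- **The principal form of the linearisation**: the bilinear form
`P = 2 Ric_g − c₁ g − 4 Hess_g w + 4 dw ⊗ dw` on `T_x M`,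
`c₁ = R_g − 4Δ_g w − 2|dw|²_g + 2(1−t)(2−t)ρ`, `ρ = backgroundScalar g w` — the coefficient of
`Hess_g φ` in `d/ds backgroundPathOperator g t (w + sφ)|₀ = ⟨P, Hess_g φ⟩_g + dφ(b)`
(`hasDerivAt_backgroundPathOperator`). By `principalForm_apply_self`, `−½P = L^t(𝔄^t_w)` is
Gursky–Viaclovsky's `L^t(g⁻¹A^t_u)` of Def. 2 (up to the conformal factor and the sign coming
from `w = −u`). [cite: GurskyViaclovsky2003, §2, Def. 2 and proof of Prop. 2] -/
def principalForm (t : ℝ) (w : M → ℝ) (x : M) : LinearMap.BilinForm ℝ (TangentSpace (𝓡 4) x) :=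
  (2 : ℝ) • g.ricci x
    + (-(g.scalarCurvature x - 4 * g.dalembertian w x - 2 * g.gradSq w x
        + 2 * ((1 - t) * (2 - t)) * backgroundScalar g w x)) • g.toBilinForm x
    + (-4 : ℝ) • g.hessian w x
    + (4 : ℝ) • ((mvfderiv (𝓡 4) w x).toLinearMap.smulRight (mvfderiv (𝓡 4) w x).toLinearMap)

/-- **The first-order field of the linearisation**: the vector
`b = −4 ♯Ric(∇w, ·) + (4Δ_g w − 4(1−t)(2−t)ρ) ∇w + 8 ♯Hess_g w(∇w, ·)` (`∇w = ♯dw`), the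
coefficient of `dφ` in `d/ds backgroundPathOperator g t (w + sφ)|₀` (Gursky–Viaclovsky's
"`+ ⋯` denotes additional terms which are linear in `∇φ`").
[cite: GurskyViaclovsky2003, §2, proof of Prop. 2] -/
def firstOrderField (t : ℝ) (w : M → ℝ) (x : M) : TangentSpace (𝓡 4) x :=
  (-4 : ℝ) • g.sharp x (g.ricci x (g.sharp x (mvfderiv (𝓡 4) w x).toLinearMap))
    + (4 * g.dalembertian w x - 4 * ((1 - t) * (2 - t)) * backgroundScalar g w x) •
        g.sharp x (mvfderiv (𝓡 4) w x).toLinearMap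
    + (8 : ℝ) • g.sharp x (g.hessian w x (g.sharp x (mvfderiv (𝓡 4) w x).toLinearMap))

/-- **The linearised weighted path operator on the background**:
`𝓛_{t,w} φ = ⟨P, Hess_g φ⟩_g + dφ(b)` with `P = principalForm g t w`, `b = firstOrderField g t w`
— the derivative of `s ↦ backgroundPathOperator g t (w + sφ)` at `s = 0`
(`hasDerivAt_backgroundPathOperator`); Gursky–Viaclovsky's `𝓛^t` of the proof of Prop. 2 read
on the background (the linearisation of the full equation `backgroundPathOperator g t w = q e^{−4w}`
is `𝓛_{t,w} φ + 4q e^{−4w} φ`). [cite: GurskyViaclovsky2003, §2, proof of Prop. 2] -/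
def linearisedBackgroundOperator (t : ℝ) (w φ : M → ℝ) (x : M) : ℝ :=
  g.innerBilin x (principalForm g t w x) (g.hessian φ x)
    + mvfderiv (𝓡 4) φ x (firstOrderField g t w x)

/-- The pairing `⟨P, K⟩_g` expanded: `2⟨Ric, K⟩ − c₁ tr_g K − 4⟨Hess w, K⟩ + 4K(∇w, ∇w)`
(`innerBilin_toBilinForm`, `innerBilin_smulRight`). [cite: GurskyViaclovsky2003, §2, proof of Prop. 2] -/
theorem innerBilin_principalForm (t : ℝ) (w : M → ℝ) (x : M)
    (K : LinearMap.BilinForm ℝ (TangentSpace (𝓡 4) x)) :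
    g.innerBilin x (principalForm g t w x) K =
      2 * g.innerBilin x (g.ricci x) K
        - (g.scalarCurvature x - 4 * g.dalembertian w x - 2 * g.gradSq w x
            + 2 * ((1 - t) * (2 - t)) * backgroundScalar g w x) * g.trace x K
        - 4 * g.innerBilin x (g.hessian w x) K
        + 4 * K (g.sharp x (mvfderiv (𝓡 4) w x).toLinearMap)
            (g.sharp x (mvfderiv (𝓡 4) w x).toLinearMap) := by
  simp only [principalForm, innerBilin_add_left, innerBilin_smul_left]
  rw [g.innerBilin_comm x (g.toBilinForm x) K, innerBilin_toBilinForm,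
    g.innerBilin_comm x (LinearMap.smulRight _ _) K, innerBilin_smulRight]
  ring

/-- The first-order part expanded: `dφ(b) = −4Ric(∇w, ∇φ) + (4Δw − 4(1−t)(2−t)ρ) g⁻¹(dw, dφ)
+ 8 Hess w(∇w, ∇φ)`. [cite: GurskyViaclovsky2003, §2, proof of Prop. 2] -/
theorem mvfderiv_firstOrderField (t : ℝ) (w φ : M → ℝ) (x : M) :
    mvfderiv (𝓡 4) φ x (firstOrderField g t w x) =
      -4 * g.ricci x (g.sharp x (mvfderiv (𝓡 4) w x).toLinearMap)
          (g.sharp x (mvfderiv (𝓡 4) φ x).toLinearMap)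
        + (4 * g.dalembertian w x - 4 * ((1 - t) * (2 - t)) * backgroundScalar g w x) *
            g.innerDual x (mvfderiv (𝓡 4) w x).toLinearMap (mvfderiv (𝓡 4) φ x).toLinearMap
        + 8 * g.hessian w x (g.sharp x (mvfderiv (𝓡 4) w x).toLinearMap)
            (g.sharp x (mvfderiv (𝓡 4) φ x).toLinearMap) := by
  have h1 : ∀ γ : Module.Dual ℝ (TangentSpace (𝓡 4) x),
      mvfderiv (𝓡 4) φ x (g.sharp x γ) = γ (g.sharp x (mvfderiv (𝓡 4) φ x).toLinearMap) :=
    fun γ ↦ apply_sharp_comm g x (mvfderiv (𝓡 4) φ x).toLinearMap γ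
  simp only [firstOrderField, map_add, map_smul, smul_eq_mul, h1]
  rfl

/-- **The linearisation of the background path operator** (Gursky–Viaclovsky 2003, proof of
Prop. 2: "Define `u_s = u + sφ`, then `𝓛^t(φ) = d/ds F_t[x, u_s, ∇u_s, ∇²u_s]|_{s=0}`"): for `w, φ`
of class `C²` at `x`, `s ↦ backgroundPathOperator g t (w + sφ)(x)` has derivative
`linearisedBackgroundOperator g t w φ x = ⟨P, Hess φ⟩_g + dφ(b)` at `s = 0`. Proof: along the
affine line `Hess(w + sφ) = Hess w + s Hess φ`, `d(w + sφ) = dw + s dφ`, `Δ(w + sφ) = Δw + sΔφ`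
(`HessianLinear.lean`), so the operator is an explicit quartic polynomial in `s` whose linear
coefficient is the stated one. [cite: GurskyViaclovsky2003, §2, proof of Prop. 2] -/
theorem hasDerivAt_backgroundPathOperator {w φ : M → ℝ} {x : M} (hw : ContMDiffAt (𝓡 4) 𝓘(ℝ, ℝ) 2 w x)
    (hφ : ContMDiffAt (𝓡 4) 𝓘(ℝ, ℝ) 2 φ x) (t : ℝ) :
    HasDerivAt (fun s ↦ backgroundPathOperator g t (fun y ↦ w y + s * φ y) x)
      (linearisedBackgroundOperator g t w φ x) 0 := by
  have hw1 : MDifferentiableAt (𝓡 4) 𝓘(ℝ, ℝ) w x := hw.mdifferentiableAt (by norm_num)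
  have hφ1 : MDifferentiableAt (𝓡 4) 𝓘(ℝ, ℝ) φ x := hφ.mdifferentiableAt (by norm_num)
  have h2le : (2 : ℕ∞ω) ≤ ∞ := WithTop.coe_le_coe.mpr le_top
  -- the atoms at `x`
  set Rc := g.ricci x with hRc
  set Hw := g.hessian w x with hHw
  set K := g.hessian φ x with hK
  set p := (mvfderiv (𝓡 4) w x).toLinearMap with hp
  set π := (mvfderiv (𝓡 4) φ x).toLinearMap with hπ
  set a := g.sharp x p with ha
  set b := g.sharp x π with hb
  set sig := g.sigma2WeylSchouten x with hsig
  set Wn := g.weylNormSq x with hWn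
  set R := g.scalarCurvature x with hR
  set Dw := g.dalembertian w x with hDw
  set Dp := g.dalembertian φ x with hDp
  set RcH := g.innerBilin x Rc Hw with hRcH
  set RcK := g.innerBilin x Rc K with hRcK
  set HH := g.normSq x Hw with hHH
  set HK := g.innerBilin x Hw K with hHK
  set KK := g.normSq x K with hKK
  set G := g.gradSq w x with hG
  set pq := g.innerDual x p π with hpq
  set Q := g.gradSq φ x with hQ
  set Raa := Rc a a with hRaa
  set Rab := Rc a b with hRab
  set Rbb := Rc b b with hRbb
  set Haa := Hw a a with hHaa
  set Hab := Hw a b with hHab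
  set Hbb := Hw b b with hHbb
  set Kaa := K a a with hKaa
  set Kab := K a b with hKab
  set Kbb := K b b with hKbb
  -- symmetries
  have hRsym : Rc b a = Rab := (g.ricci_symm_holds h2le x).eq b a
  have hHsym : Hw b a = Hab := (g.hessian_symm_holds hw).eq b a
  have hKsym : K b a = Kab := (g.hessian_symm_holds hφ).eq b a
  -- the operator along the line, as an explicit polynomial in `s`
  set poly : ℝ → ℝ := fun s ↦
    sig + (2 * (RcH + s * RcK) - R * (Dw + s * Dp))
      + 2 * ((Dw + s * Dp) ^ 2 - (HH + 2 * s * HK + s ^ 2 * KK)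
          - (Raa + 2 * s * Rab + s ^ 2 * Rbb))
      + 2 * ((Dw + s * Dp) * (G + 2 * s * pq + s ^ 2 * Q)
          + 2 * ((Haa + 2 * s * Hab + s ^ 2 * Hbb) + s * (Kaa + 2 * s * Kab + s ^ 2 * Kbb)))
      - 1 / 4 * Wn
      + (1 - t) * (2 - t) * (R - 6 * (Dw + s * Dp) - 6 * (G + 2 * s * pq + s ^ 2 * Q)) ^ 2 / 6
    with hpoly
  have key : ∀ s, backgroundPathOperator g t (fun y ↦ w y + s * φ y) x = poly s := by
    intro s
    have eH := g.hessian_add_const_mul hw hφ s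
    have eD := g.dalembertian_add_const_mul_of_contMDiffAt hw hφ s
    have eG := g.gradSq_add_const_mul hw1 hφ1 s
    have eP := mvfderiv_toLinearMap_add_const_mul x hw1 hφ1 s
    simp only [backgroundPathOperator, backgroundScalar, eH, eD, eG, eP, hpoly, map_add, map_smul,
      LinearMap.add_apply, LinearMap.smul_apply, smul_eq_mul, innerBilin_add_right,
      innerBilin_smul_right, normSq_add_smul]
    linear_combination (-2 * s) * hRsym + (4 * s) * hHsym + (4 * s ^ 2) * hKsym
  -- the linear coefficient
  set L := 2 * RcK - R * Dp + 4 * Dw * Dp - 4 * HK - 4 * Rab + 2 * Dp * G + 4 * Dw * pq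
    + 4 * Kaa + 8 * Hab - (1 - t) * (2 - t) * (R - 6 * Dw - 6 * G) * (2 * Dp + 4 * pq) with hL
  set C : ℝ → ℝ := fun s ↦
      (14:ℝ) * Dp ^ 2 + (4:ℝ) * Hbb + (-2:ℝ) * KK + (8:ℝ) * Kab + (-2:ℝ) * Rbb +
      (48:ℝ) * pq ^ 2 + (52:ℝ) * Dp * pq + (-18:ℝ) * Dp ^ 2 * t + (6:ℝ) * Dp ^ 2 * t ^ 2 +
      (26:ℝ) * Dw * Q + (24:ℝ) * G * Q + (4:ℝ) * Kbb * s + (-4:ℝ) * Q * R +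
      (12:ℝ) * Q ^ 2 * s ^ 2 + (-72:ℝ) * pq ^ 2 * t + (24:ℝ) * pq ^ 2 * t ^ 2 +
      (26:ℝ) * Dp * Q * s + (-72:ℝ) * Dp * pq * t + (24:ℝ) * Dp * pq * t ^ 2 +
      (-36:ℝ) * Dw * Q * t + (12:ℝ) * Dw * Q * t ^ 2 + (-36:ℝ) * G * Q * t +
      (12:ℝ) * G * Q * t ^ 2 + (6:ℝ) * Q * R * t + (-2:ℝ) * Q * R * t ^ 2 + (48:ℝ) * Q * pq * s +
      (-18:ℝ) * Q ^ 2 * s ^ 2 * t + (6:ℝ) * Q ^ 2 * s ^ 2 * t ^ 2 + (-36:ℝ) * Dp * Q * s * t +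
      (12:ℝ) * Dp * Q * s * t ^ 2 + (-72:ℝ) * Q * pq * s * t + (24:ℝ) * Q * pq * s * t ^ 2
    with hC
  have hsplit : ∀ s, poly s = poly 0 + s * L + s ^ 2 * C s := by
    intro s
    simp only [hpoly, hC, hL]
    ring
  have hCd : DifferentiableAt ℝ C 0 := by
    simp only [hC]
    fun_prop
  have hd1 : HasDerivAt (fun s : ℝ ↦ poly 0 + s * L) L 0 := by
    simpa using ((hasDerivAt_id (0 : ℝ)).mul_const L).const_add (poly 0)
  have hd2 : HasDerivAt (fun s : ℝ ↦ s ^ 2 * C s) 0 0 := by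
    have h := (hasDerivAt_pow 2 (0 : ℝ)).mul hCd.hasDerivAt
    exact h.congr_deriv (by simp)
  have hd : HasDerivAt poly L 0 := by
    have h := hd1.add hd2
    rw [add_zero] at h
    refine h.congr_of_eventuallyEq (Eventually.of_forall fun s ↦ ?_)
    simp only [Pi.add_apply, hsplit s]
  -- identify `L` with the linearised operator and conclude
  have hLeq : linearisedBackgroundOperator g t w φ x = L := by
    rw [linearisedBackgroundOperator, innerBilin_principalForm, mvfderiv_firstOrderField, hL]
    change 2 * RcK - (R - 4 * Dw - 2 * G + 2 * ((1 - t) * (2 - t)) * (R - 6 * Dw - 6 * G)) * Dp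
        - 4 * HK + 4 * Kaa + (-4 * Rab + (4 * Dw - 4 * ((1 - t) * (2 - t)) * (R - 6 * Dw - 6 * G)) * pq
        + 8 * Hab) = _
    ring
  rw [hLeq]
  have hfun : (fun s ↦ backgroundPathOperator g t (fun y ↦ w y + s * φ y) x) = poly := funext key
  rw [hfun]
  exact hd

end Linearisation

/-! ### `σ₂` of `𝔄^t_w` and the ellipticity of the principal form -/

section Sigma2

variable {M : Type*} [TopologicalSpace M] [ChartedSpace (EuclideanSpace ℝ (Fin 4)) M]
  [IsManifold (𝓡 4) ∞ M]
  (g : PseudoRiemannianMetric (𝓡 4) ∞ (EuclideanSpace ℝ (Fin 4)) (TangentSpace (𝓡 4) : M → Type _))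
  [g.HasLeviCivita]

/-- **The form `𝔄^t_w = A_g − 2Hess_g w + 2dw⊗dw − |dw|²_g g + ((1−t)/6)ρ g`** on `T_x M`
(`A_g = Ric − (R/6)g` the tree's Weyl–Schouten tensor, `ρ = backgroundScalar g w`): by the
conformal law of the Weyl–Schouten tensor (Chang–Gursky–Yang 2002, (0.4); tree:
`weylSchouten_conformal_exp_four`) `A_g − 2Hess w + 2dw⊗dw − |dw|²g = A_h` for `h = e^{2w}g`, and
the last term is Gursky–Viaclovsky's passage `A¹ ↦ A^t = A¹ + ((1−t)/2)σ₁(A¹)` (§1) read on `g`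
(`𝔄^t_w = 2A^t_h` as a `(0,2)`-tensor). Its trace is `(3−2t)ρ/3` (`trace_weylSchoutenT`) and
`σ₂(𝔄^t_w) = ½((tr 𝔄^t_w)² − |𝔄^t_w|²_g) = backgroundPathOperator g t w + ¼|W_g|²`
(`backgroundPathOperator_eq_sigma2`). [cite: GurskyViaclovsky2003, §1 (A^t) and §2, Def. 1]
[cite: ChangGurskyYang2002, (0.4)] -/
def weylSchoutenT (t : ℝ) (w : M → ℝ) (x : M) : LinearMap.BilinForm ℝ (TangentSpace (𝓡 4) x) :=
  g.ricci x
    + (-g.scalarCurvature x / 6 - g.gradSq w x + (1 - t) / 6 * backgroundScalar g w x) •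
        g.toBilinForm x
    + (-2 : ℝ) • g.hessian w x
    + (2 : ℝ) • ((mvfderiv (𝓡 4) w x).toLinearMap.smulRight (mvfderiv (𝓡 4) w x).toLinearMap)

/-- `𝔄^t_w` evaluated on a pair of vectors. [cite: GurskyViaclovsky2003, §1 (A^t)] -/
theorem weylSchoutenT_apply (t : ℝ) (w : M → ℝ) (x : M) (v v' : TangentSpace (𝓡 4) x) :
    weylSchoutenT g t w x v v' =
      g.ricci x v v'
        + (-g.scalarCurvature x / 6 - g.gradSq w x + (1 - t) / 6 * backgroundScalar g w x) *
            g.val x v v'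
        - 2 * g.hessian w x v v' + 2 * (mvfderiv (𝓡 4) w x v * mvfderiv (𝓡 4) w x v') := by
  simp only [weylSchoutenT, LinearMap.add_apply, LinearMap.smul_apply, smul_eq_mul,
    LinearMap.smulRight_apply, toBilinForm_apply, ContinuousLinearMap.coe_coe]
  ring

/-- `P` evaluated on a pair of vectors. [cite: GurskyViaclovsky2003, §2, proof of Prop. 2] -/
theorem principalForm_apply (t : ℝ) (w : M → ℝ) (x : M) (v v' : TangentSpace (𝓡 4) x) :
    principalForm g t w x v v' =
      2 * g.ricci x v v'
        - (g.scalarCurvature x - 4 * g.dalembertian w x - 2 * g.gradSq w x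
            + 2 * ((1 - t) * (2 - t)) * backgroundScalar g w x) * g.val x v v'
        - 4 * g.hessian w x v v' + 4 * (mvfderiv (𝓡 4) w x v * mvfderiv (𝓡 4) w x v') := by
  simp only [principalForm, LinearMap.add_apply, LinearMap.smul_apply, smul_eq_mul,
    LinearMap.smulRight_apply, toBilinForm_apply, ContinuousLinearMap.coe_coe]
  ring

/-- **`tr_g 𝔄^t_w = (3 − 2t)ρ/3`** (`tr Ric = R`, `tr g = 4`, `tr Hess w = Δw`, `tr dw⊗dw = |dw|²`;
Gursky–Viaclovsky: `σ₁(A^t) = (3−2t)σ₁(A¹)`). [cite: GurskyViaclovsky2003, §1 (A^t)] -/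
theorem trace_weylSchoutenT (t : ℝ) (w : M → ℝ) (x : M) :
    g.trace x (weylSchoutenT g t w x) = (3 - 2 * t) * backgroundScalar g w x / 3 := by
  have h1 : g.trace x (g.ricci x) = g.scalarCurvature x := rfl
  have h2 : g.trace x (g.hessian w x) = g.dalembertian w x := rfl
  have h3 : g.innerDual x (mvfderiv (𝓡 4) w x).toLinearMap (mvfderiv (𝓡 4) w x).toLinearMap =
      g.gradSq w x := rfl
  simp only [weylSchoutenT, trace_add, trace_smul, trace_toBilinForm_four g x finrank_euclideanSpace_fin,
    trace_smulRight_dual, h1, h2, h3]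
  simp only [backgroundScalar]
  ring

/-- **`|𝔄^t_w|²_g` expanded** through the Gram table of `{Ric, g, Hess w, dw⊗dw}` for the metric
pairing: `⟨Ric, g⟩ = R`, `⟨Ric, dw⊗dw⟩ = Ric(∇w,∇w)`, `|g|² = 4`, `⟨g, Hess w⟩ = Δw`,
`⟨g, dw⊗dw⟩ = |dw|²`, `⟨Hess w, dw⊗dw⟩ = Hess w(∇w,∇w)`, `|dw⊗dw|² = |dw|⁴`
(`innerBilin_toBilinForm`, `innerBilin_smulRight`). [folklore] -/
theorem normSq_weylSchoutenT (t : ℝ) (w : M → ℝ) (x : M) :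
    g.normSq x (weylSchoutenT g t w x) =
      g.normSq x (g.ricci x)
        + 2 * (-g.scalarCurvature x / 6 - g.gradSq w x + (1 - t) / 6 * backgroundScalar g w x) *
            g.scalarCurvature x
        - 4 * g.innerBilin x (g.ricci x) (g.hessian w x)
        + 4 * g.ricci x (g.sharp x (mvfderiv (𝓡 4) w x).toLinearMap)
            (g.sharp x (mvfderiv (𝓡 4) w x).toLinearMap)
        + 4 * (-g.scalarCurvature x / 6 - g.gradSq w x + (1 - t) / 6 * backgroundScalar g w x) ^ 2
        - 4 * (-g.scalarCurvature x / 6 - g.gradSq w x + (1 - t) / 6 * backgroundScalar g w x) *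
            g.dalembertian w x
        + 4 * (-g.scalarCurvature x / 6 - g.gradSq w x + (1 - t) / 6 * backgroundScalar g w x) *
            g.gradSq w x
        + 4 * g.normSq x (g.hessian w x)
        - 8 * g.hessian w x (g.sharp x (mvfderiv (𝓡 4) w x).toLinearMap)
            (g.sharp x (mvfderiv (𝓡 4) w x).toLinearMap)
        + 4 * g.gradSq w x ^ 2 := by
  set Rc := g.ricci x with hRc
  set gB := g.toBilinForm x with hgB
  set Hw := g.hessian w x with hHw
  set p := (mvfderiv (𝓡 4) w x).toLinearMap with hp
  set pp : LinearMap.BilinForm ℝ (TangentSpace (𝓡 4) x) := p.smulRight p with hpp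
  set a := g.sharp x p with ha
  set c := -g.scalarCurvature x / 6 - g.gradSq w x + (1 - t) / 6 * backgroundScalar g w x with hc
  -- the Gram table
  have hpa : p a = g.gradSq w x := rfl
  have e12 : g.innerBilin x Rc gB = g.scalarCurvature x := by
    rw [hgB, innerBilin_toBilinForm]; rfl
  have e21 : g.innerBilin x gB Rc = g.scalarCurvature x := by rw [g.innerBilin_comm x, e12]
  have e14 : g.innerBilin x Rc pp = Rc a a := by rw [hpp, innerBilin_smulRight]
  have e41 : g.innerBilin x pp Rc = Rc a a := by rw [g.innerBilin_comm x, e14]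
  have e22 : g.normSq x gB = 4 := by
    rw [← innerBilin_self, hgB, innerBilin_toBilinForm, trace_toBilinForm_four g x finrank_euclideanSpace_fin]
  have e23 : g.innerBilin x gB Hw = g.dalembertian w x := by
    rw [g.innerBilin_comm x, hgB, innerBilin_toBilinForm]; rfl
  have e32 : g.innerBilin x Hw gB = g.dalembertian w x := by rw [g.innerBilin_comm x, e23]
  have e24 : g.innerBilin x gB pp = g.gradSq w x := by
    rw [hpp, innerBilin_smulRight, hgB, toBilinForm_apply, ← ha, val_sharp_apply, hpa]
  have e42 : g.innerBilin x pp gB = g.gradSq w x := by rw [g.innerBilin_comm x, e24]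
  have e34 : g.innerBilin x Hw pp = Hw a a := by rw [hpp, innerBilin_smulRight]
  have e43 : g.innerBilin x pp Hw = Hw a a := by rw [g.innerBilin_comm x, e34]
  have e13 : g.innerBilin x Hw Rc = g.innerBilin x Rc Hw := g.innerBilin_comm x Hw Rc
  have e11 : g.innerBilin x Rc Rc = g.normSq x Rc := rfl
  have e33 : g.innerBilin x Hw Hw = g.normSq x Hw := rfl
  have e22' : g.innerBilin x gB gB = 4 := by rw [innerBilin_self, e22]
  have e44 : g.innerBilin x pp pp = g.gradSq w x ^ 2 := by
    rw [hpp, innerBilin_smulRight, smulRight_apply_sharp_sharp]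
    rfl
  have hT : weylSchoutenT g t w x = Rc + c • gB + (-2 : ℝ) • Hw + (2 : ℝ) • pp := rfl
  rw [hT, ← innerBilin_self]
  simp only [innerBilin_add_left, innerBilin_add_right, innerBilin_smul_left,
    innerBilin_smul_right, e12, e21, e14, e41, e22', e23, e32, e24, e42, e34, e43, e13, e11, e33,
    e44]
  ring

/-- **`backgroundPathOperator g t w = σ₂(𝔄^t_w) − ¼|W_g|²`** with
`σ₂(T) = ½((tr_g T)² − |T|²_g)`: the weighted path operator on the background IS the second
symmetric function of `𝔄^t_w` (up to the Weyl weight) — Gursky–Viaclovsky's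
`σ₂(A^t) = σ₂(A¹) + (3/2)(1−t)(2−t)σ₁(A¹)²` (proof of Prop. 4) combined with the conformal law,
here verified directly from `σ₂(A_g) = −½|E|² + R²/24` (`sigma2WeylSchouten_eq`,
`tracelessRicciNormSq_eq_normSq`) and the Gram table. Consequently at a solution
(`backgroundPathOperator = q e^{−4w} > 0`) one has `σ₂(𝔄^t_w) > 0`.
[cite: GurskyViaclovsky2003, §1 (PDE), proof of Prop. 4] -/
theorem backgroundPathOperator_eq_sigma2 (hg : g.IsRiemannian) (t : ℝ) (w : M → ℝ) (x : M) :
    backgroundPathOperator g t w x =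
      1 / 2 * (g.trace x (weylSchoutenT g t w x) ^ 2 - g.normSq x (weylSchoutenT g t w x))
        - 1 / 4 * g.weylNormSq x := by
  have hE : finrank ℝ (EuclideanSpace ℝ (Fin 4)) = 4 := finrank_euclideanSpace_fin
  have h2le : (2 : ℕ∞ω) ≤ ∞ := WithTop.coe_le_coe.mpr le_top
  have hσ := g.sigma2WeylSchouten_eq h2le hE (x := x) (fun v hv ↦ hg x v hv)
  have hEn := g.tracelessRicciNormSq_eq_normSq hg hE x
  rw [trace_weylSchoutenT, normSq_weylSchoutenT]
  simp only [backgroundPathOperator, backgroundScalar, hσ, hEn]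
  ring

/-- **`−½ P = L^t(𝔄^t_w)` on the diagonal**: for every `v`,
`−½ P(v,v) = (1 + 3(1−t)/2)·tr_g(𝔄^t_w)·g(v,v) − 𝔄^t_w(v,v)`, i.e. `−½P` is the form
`L^t(T) = T₁(T) + ((1−t)/2)σ₁(T₁(T)) g`, `T₁(T) = σ₁(T) g − T`, of Gursky–Viaclovsky's Def. 2 at
`T = 𝔄^t_w` (dimension four: `σ₁(T₁(T)) = 3σ₁(T)`). With Prop. 1 (ii)
(`apply_self_lt_Lt_mul`) this is the ellipticity of the linearised operator for `t ≤ 1` on `Γ₂⁺`.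
[cite: GurskyViaclovsky2003, §2, Def. 2 and proof of Prop. 2] -/
theorem principalForm_apply_self (t : ℝ) (w : M → ℝ) (x : M) (v : TangentSpace (𝓡 4) x) :
    principalForm g t w x v v =
      -2 * ((1 + 3 * (1 - t) / 2) * g.trace x (weylSchoutenT g t w x) * g.val x v v
        - weylSchoutenT g t w x v v) := by
  rw [principalForm_apply, trace_weylSchoutenT, weylSchoutenT_apply]
  simp only [backgroundScalar]
  ring

end Sigma2

/-! ### The kernel of the linearisation is trivial (Prop. 2, injectivity) -/

section Kernel

variable {M : Type*} [TopologicalSpace M] [ChartedSpace (EuclideanSpace ℝ (Fin 4)) M]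
  [IsManifold (𝓡 4) ∞ M]
  (g : PseudoRiemannianMetric (𝓡 4) ∞ (EuclideanSpace ℝ (Fin 4)) (TangentSpace (𝓡 4) : M → Type _))
  [g.HasLeviCivita]

/-- **Ellipticity at an admissible solution**: if `backgroundScalar g w > 0` and
`backgroundPathOperator g t w = q e^{−4w}` with `q > 0` at `x`, and `t ≤ 1`, then `−P_x` is
positive semidefinite (indeed definite): `0 ≤ −P(v,v)` — `𝔄^t_w ∈ Γ₂⁺` by
`backgroundPathOperator_eq_sigma2` (`|W|² ≥ 0`) and `trace_weylSchoutenT`, then Prop. 1 (ii)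
(`apply_self_lt_Lt_mul`) and `principalForm_apply_self`.
[cite: GurskyViaclovsky2003, §2, Prop. 1 (ii) and proof of Prop. 2] -/
theorem neg_principalForm_apply_self_nonneg (hg : g.IsRiemannian) {t : ℝ} (ht : t ≤ 1)
    {w : M → ℝ} {q : M → ℝ} {x : M} (hρ : 0 < backgroundScalar g w x) (hq : 0 < q x)
    (heq : backgroundPathOperator g t w x = q x * Real.exp (-4 * w x))
    (v : TangentSpace (𝓡 4) x) : 0 ≤ -(principalForm g t w x v v) := by
  by_cases hv : v = 0
  · subst hv
    simp
  · have hpos : ∀ u : TangentSpace (𝓡 4) x, u ≠ 0 → 0 < g.val x u u := fun u hu ↦ hg x u hu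
    have htr : 0 < g.trace x (weylSchoutenT g t w x) := by
      rw [trace_weylSchoutenT]
      have : 0 < 3 - 2 * t := by linarith
      positivity
    have hσ : g.normSq x (weylSchoutenT g t w x) < g.trace x (weylSchoutenT g t w x) ^ 2 := by
      have h1 := backgroundPathOperator_eq_sigma2 g hg t w x
      have h2 : 0 < backgroundPathOperator g t w x := by
        rw [heq]; exact mul_pos hq (Real.exp_pos _)
      have h3 : 0 ≤ g.weylNormSq x := g.weylNormSq_nonneg x
      nlinarith
    have key := apply_self_lt_Lt_mul g hpos (weylSchoutenT g t w x) htr hσ ht hv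
    rw [principalForm_apply_self]
    nlinarith

/-- **Gursky–Viaclovsky 2003, Prop. 2 (injectivity half), for the weighted path on the
background.** Let `M` be a closed `4`-manifold with a smooth Riemannian `g`, `t ≤ 1`, `q > 0`
continuous, and `w` a `C²` admissible solution of the background equation
(`backgroundScalar g w > 0`, `backgroundPathOperator g t w = q e^{−4w}`). If `φ ∈ C²(M)` lies in
the kernel of the linearisation of `w ↦ backgroundPathOperator g t w − q e^{−4w}`, i.e.
`𝓛_{t,w}φ + 4q e^{−4w}φ = 0` everywhere, then `φ = 0`: the operator `−(𝓛 + 4qe^{−4w})` has the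
form `⟨−P, Hess φ⟩_g + dφ(−b) + cφ` with `−P ≥ 0` (`neg_principalForm_apply_self_nonneg`) and
`c = −4q e^{−4w} ≤ −c₀ < 0` on the compact `M`, so the maximum principle
(`eq_zero_of_maximumPrinciple`) applies — "Since the coefficient of `φ` in the zeroth-order term
is strictly negative, the linearization is furthermore invertible".
[cite: GurskyViaclovsky2003, §2, Prop. 2] -/
theorem eq_zero_of_linearised_eq_zero [CompactSpace M] (hg : g.IsRiemannian) {t : ℝ} (ht : t ≤ 1)
    {q : M → ℝ} (hqc : Continuous q) (hq : ∀ x, 0 < q x)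
    {w : M → ℝ} (hw : ContMDiff (𝓡 4) 𝓘(ℝ, ℝ) 2 w) (hρ : ∀ x, 0 < backgroundScalar g w x)
    (heq : ∀ x, backgroundPathOperator g t w x = q x * Real.exp (-4 * w x))
    {φ : M → ℝ} (hφ : ContMDiff (𝓡 4) 𝓘(ℝ, ℝ) 2 φ)
    (hL : ∀ x, linearisedBackgroundOperator g t w φ x + 4 * q x * Real.exp (-4 * w x) * φ x = 0) :
    φ = 0 := by
  rcases isEmpty_or_nonempty M with hM | hM
  · funext x; exact (IsEmpty.false x).elim
  -- the zeroth-order coefficient is bounded away from zero on the compact manifold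
  have hcont : Continuous fun x ↦ q x * Real.exp (-4 * w x) :=
    hqc.mul (Real.continuous_exp.comp (continuous_const.mul hw.continuous))
  obtain ⟨x₀, -, hx₀⟩ := isCompact_univ.exists_isMinOn univ_nonempty hcont.continuousOn
  set c₀ := 4 * (q x₀ * Real.exp (-4 * w x₀)) with hc₀
  have hc₀pos : 0 < c₀ := by
    have := mul_pos (hq x₀) (Real.exp_pos (-4 * w x₀))
    positivity
  have h2le : (2 : ℕ∞ω) ≤ ∞ := WithTop.coe_le_coe.mpr le_top
  refine eq_zero_of_maximumPrinciple g (fun x v hv ↦ hg x v hv)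
    (P := fun x ↦ (-1 : ℝ) • principalForm g t w x) ?_ ?_ (fun x ↦ -firstOrderField g t w x)
    (c := fun x ↦ -(4 * q x * Real.exp (-4 * w x))) hc₀pos ?_ hφ ?_
  · -- symmetry of `−P`
    intro x v v'
    have hR : g.ricci x v v' = g.ricci x v' v := (g.ricci_symm_holds h2le x).eq v v'
    have hH : g.hessian w x v v' = g.hessian w x v' v := (g.hessian_symm_holds (hw x)).eq v v'
    simp only [LinearMap.smul_apply, smul_eq_mul, principalForm_apply]
    rw [hR, hH, g.symm x v v', mul_comm (mvfderiv (𝓡 4) w x v) (mvfderiv (𝓡 4) w x v')]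
  · -- `−P ≥ 0`
    intro x v
    simp only [LinearMap.smul_apply, smul_eq_mul, neg_one_mul]
    exact neg_principalForm_apply_self_nonneg g hg ht (hρ x) (hq x) (heq x) v
  · -- `c ≤ −c₀`
    intro x
    have hmin : q x₀ * Real.exp (-4 * w x₀) ≤ q x * Real.exp (-4 * w x) := hx₀ (mem_univ x)
    simp only [hc₀]
    linarith
  · -- the equation
    intro x
    have h := hL x
    simp only [linearisedBackgroundOperator] at h
    simp only [innerBilin_smul_left, map_neg]
    linarith

end Kernel

end Literature.Geometry.Riemannian.GurskyViaclovskyPath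

end
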